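import Summits.QuantumFields.BalabanUV.Beta.D1BFx.LatticeHLSDamped
import Summits.QuantumFields.BalabanUV.Beta.D1BFx.RankOneBubbleJets

/-!
# `BalabanUV.Beta.D1BFx.PairingByParts` — road «BF-x» for binder row D1, slot (K), END row `hGrp gN`, «PAIRING-BY-PARTS»: LATTICE SUMMATION BY PARTS IN THE
# RANK-ONE BUBBLE FRAME — `A(∇f) = A⁻ f`, `⟨∇f, χ⟩ = ⟨f, χ⁻⟩`, `χ⁻ = A^{←} φ` for `χ = Aφ` (backward differences of the leg), the ONE-STEP SHIFTS of damped
# Coulomb letters, and the by-parts form of (L1)-d1: `|(A∇f)(x)| ≤ 4·K₁·B·C₄·e^{−ε‖x−v‖}∕nrm(x−v)²` for a site function with the dipole letter `B·e∕nrm³`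

HONEST DEPENDENCY (cell records, verbatim): «continuum YM on T⁴ ⇐ BetaPertH ∧ nine spine estimates (0/9 proved); BetaPertH ⇐ (D1) ∧ (D4) ∧
CAP+tail; G-an2-4 gates asym, D1 and NE2/3/4.»  HONEST FRAMING (cell contract, verbatim): «discharging `BetaPertH` makes Bałaban's UV stability
UNCONDITIONAL — a real constructive-QFT result; it is NOT the continuum limit and NOT the Clay problem.»  THIS MODULE DISCHARGES NOTHING of the
wall: [folklore] `tsum` algebra (shift by `Equiv.addRight`, `Summable.tsum_finsetSum`, `Summable.tsum_sub`) over the owner's `RankOneBubble.applyK` ∕ `pairing`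
and `RankOneBubbleJets.grad`, plus leaf-04-g9's damped HLS kit (`LatticeHLSDamped.abs_applyK_le_of_damped_profiles`).  No `def`, no `def … : Prop`,
nothing cited, 0 sorry.  Root-level binders hW ∕ hR-sockets ∕ hSX-socket ∕ D1Tel ∕ D1Rep — 0 discharged; (K) NOT closed; NOT D1, NOT `BetaPertH`, NOT
continuum, NOT Clay.

WHY (cell «GN-33∕KK», leaf-04-g9 STATEMENT-FIRST journal 2026-08-21T11:16Z): the source dipole `δρ_u = RG(·,u⁺) − RG(·,u)` has the `r⁻³` letter
(`RColumnProfileDipole`) but its GRADIENT has no `r⁻⁴` letter; every placement `Ga∇δρ` ∕ `⟨∇δρ, χ⟩` of the dipole cells is therefore summed by parts onto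
the gluon leg, whose first differences DO have the `r⁻³` letter (`GluonLegProfileD1`).  These are the identities and the resulting profile.

CONTENT (`D = 4`, bond fibre `Fin 4`; legs `A : MKer 4 (Fin 4)`, site functions `f : Site 4 → ℝ`, bond functions `φ χ : Site 4 → Fin 4 → ℝ`).
* §1 [folklore] **`applyK_grad_eq`** (`applyK A (grad f) x c = applyK (fun x y c b ↦ A x (y−e_b) c b − A x y c b) (fun y _ ↦ f y) x c`), **`pairing_grad_eq`**
  (`pairing (grad f) χ = pairing (fun x _ ↦ f x) (fun x a ↦ χ (x−e_a) a − χ x a)`), **`applyK_shift_sub`** (`(Aφ)(x−e_a,a) − (Aφ)(x,a) = (A^{←}φ)(x,a)`), under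
  the obvious summability hypotheses.
* §2 [folklore] `profile_shift_le` (one lattice step costs `2^p·e^{ε₁}` in a damped Coulomb letter, `ε ≤ ε₁`), and the backward-difference letters
  `abs_sub_left_le_of_letter`, `abs_sub_right_le_of_letter`, `abs_shift_right_le_of_letter` read off forward-difference ∕ entry letters.
* §3 [folklore] **`abs_applyK_grad_le_of_damped_profiles`** — `|applyK A (grad f) x c| ≤ 4·K₁·B·C₄·e^{−ε‖x−v‖∞}∕nrm(x−v)²` from the backward d1 letter
  `K₁e∕nrm³` of the leg (second slot), an entry letter for summability, and `|f y| ≤ B·e^{−ε‖y−v‖∞}∕nrm(y−v)³` (`C₄ = 4·2⁷·9³`).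
Unit `b2b-balaban-beta-d1-formalise-leaf-04` (gen 9); `LEAVES-BFx.md` row (N) «PAIRING-BY-PARTS».
-/

noncomputable section

namespace Summit.QuantumFields.BalabanUV.Beta.D1BFx.PairingByParts

open Finset
open scoped BigOperators
open Literature.MathematicalPhysics.QuantumFieldTheory.Balaban1983to89
open Literature.MathematicalPhysics.QuantumFieldTheory.Balaban1983to89.Beta
open ExpKernelCalculus (Site MKer)
open AffineAveraging (unitVec)
open PoissonInterior (nrm nrm_pos one_le_nrm nrm_neg supNorm supNorm_add_le supNorm_single_one supNorm_neg)
open Summit.QuantumFields.BalabanUV.Beta.D1BFx.RankOneBubble (applyK pairing)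
open Summit.QuantumFields.BalabanUV.Beta.D1BFx.RankOneBubbleJets (grad grad_apply)
open Summit.QuantumFields.BalabanUV.Beta.D1BFx.LatticeHLSRadial (nrm_eq_max)
open Summit.QuantumFields.BalabanUV.Beta.D1BFx.LatticeHLSProfiles (summable_and_abs_tsum_le_of_abs_sum_le)
open Summit.QuantumFields.BalabanUV.Beta.D1BFx.LatticeHLSDamped (abs_sum_mul_le_of_damped_profiles abs_applyK_le_of_damped_profiles)

/-! ## §1 The three summation-by-parts identities -/

/-- [folklore] **BY PARTS INSIDE THE LEG**: `(A∇f)(x,c) = Σ'_y Σ_b (A(x,y−e_b)_{cb} − A(x,y)_{cb})·f(y)`, i.e. `applyK A (grad f) = applyK A⁻ f` with the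
backward difference `A⁻` of the leg in its second site; hypotheses: the two summabilities that make both sides converge absolutely. -/
theorem applyK_grad_eq (A : MKer 4 (Fin 4)) (f : Site 4 → ℝ) (x : Site 4) (c : Fin 4)
    (h1 : ∀ b : Fin 4, Summable fun y : Site 4 => A x y c b * f y)
    (h2 : ∀ b : Fin 4, Summable fun y : Site 4 => A x (y - unitVec b) c b * f y) :
    applyK A (grad f) x c = applyK (fun x y c b => A x (y - unitVec b) c b - A x y c b) (fun y (_ : Fin 4) => f y) x c := by
  -- the shifted summability `y ↦ A x y c b · f (y + e_b)`
  have h3 : ∀ b : Fin 4, Summable fun y : Site 4 => A x y c b * f (y + unitVec b) := fun b => by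
    have h := (Equiv.addRight (unitVec b)).summable_iff.mpr (h2 b)
    refine h.congr fun y => ?_
    simp only [Function.comp, Equiv.coe_addRight, add_sub_cancel_right]
  have hshift : ∀ b : Fin 4, ∑' y : Site 4, A x y c b * f (y + unitVec b) = ∑' y : Site 4, A x (y - unitVec b) c b * f y := fun b => by
    rw [← (Equiv.addRight (unitVec b)).tsum_eq (fun y : Site 4 => A x (y - unitVec b) c b * f y)]
    refine tsum_congr fun y => ?_
    simp only [Equiv.coe_addRight, add_sub_cancel_right]
  unfold applyK
  have eL : ∀ y : Site 4, ∑ b, A x y c b * grad f y b = (∑ b, A x y c b * f (y + unitVec b)) - ∑ b, A x y c b * f y := fun y => by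
    rw [← Finset.sum_sub_distrib]
    exact Finset.sum_congr rfl fun b _ => by rw [grad_apply]; ring
  have eR : ∀ y : Site 4, ∑ b, (A x (y - unitVec b) c b - A x y c b) * f y = (∑ b, A x (y - unitVec b) c b * f y) - ∑ b, A x y c b * f y :=
    fun y => by rw [← Finset.sum_sub_distrib]; exact Finset.sum_congr rfl fun b _ => by ring
  rw [tsum_congr eL, tsum_congr eR, (summable_sum fun b _ => h3 b).tsum_sub (summable_sum fun b _ => h1 b),
    (summable_sum fun b _ => h2 b).tsum_sub (summable_sum fun b _ => h1 b),
    Summable.tsum_finsetSum (fun b _ => h3 b), Summable.tsum_finsetSum (fun b _ => h2 b)]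
  congr 1
  exact Finset.sum_congr rfl fun b _ => hshift b

/-- [folklore] **BY PARTS AT THE PAIRING**: `⟨∇f, χ⟩ = Σ'_x Σ_a f(x)·(χ(x−e_a,a) − χ(x,a))`, i.e. `pairing (grad f) χ = pairing f χ⁻` with the backward
divergence-type difference `χ⁻`; hypotheses: the two summabilities. -/
theorem pairing_grad_eq (f : Site 4 → ℝ) (χ : Site 4 → Fin 4 → ℝ)
    (h1 : ∀ a : Fin 4, Summable fun x : Site 4 => f x * χ x a)
    (h2 : ∀ a : Fin 4, Summable fun x : Site 4 => f x * χ (x - unitVec a) a) :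
    pairing (grad f) χ = pairing (fun x (_ : Fin 4) => f x) (fun x a => χ (x - unitVec a) a - χ x a) := by
  have h3 : ∀ a : Fin 4, Summable fun x : Site 4 => f (x + unitVec a) * χ x a := fun a => by
    have h := (Equiv.addRight (unitVec a)).summable_iff.mpr (h2 a)
    refine h.congr fun x => ?_
    simp only [Function.comp, Equiv.coe_addRight, add_sub_cancel_right]
  have hshift : ∀ a : Fin 4, ∑' x : Site 4, f (x + unitVec a) * χ x a = ∑' x : Site 4, f x * χ (x - unitVec a) a := fun a => by
    rw [← (Equiv.addRight (unitVec a)).tsum_eq (fun x : Site 4 => f x * χ (x - unitVec a) a)]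
    refine tsum_congr fun x => ?_
    simp only [Equiv.coe_addRight, add_sub_cancel_right]
  unfold pairing
  have eL : ∀ x : Site 4, ∑ a, grad f x a * χ x a = (∑ a, f (x + unitVec a) * χ x a) - ∑ a, f x * χ x a := fun x => by
    rw [← Finset.sum_sub_distrib]
    exact Finset.sum_congr rfl fun a _ => by rw [grad_apply]; ring
  have eR : ∀ x : Site 4, ∑ a, f x * (χ (x - unitVec a) a - χ x a) = (∑ a, f x * χ (x - unitVec a) a) - ∑ a, f x * χ x a :=
    fun x => by rw [← Finset.sum_sub_distrib]; exact Finset.sum_congr rfl fun a _ => by ring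
  rw [tsum_congr eL, tsum_congr eR, (summable_sum fun a _ => h3 a).tsum_sub (summable_sum fun a _ => h1 a),
    (summable_sum fun a _ => h2 a).tsum_sub (summable_sum fun a _ => h1 a),
    Summable.tsum_finsetSum (fun a _ => h3 a), Summable.tsum_finsetSum (fun a _ => h2 a)]
  congr 1
  exact Finset.sum_congr rfl fun a _ => hshift a

/-- [folklore] **THE SHIFTED-MINUS-UNSHIFTED LEG OUTPUT IS THE OUTPUT OF THE BACKWARD-DIFFERENCED LEG**: for `χ = Aφ`,
`χ(x−e_a, a) − χ(x, a) = Σ'_y Σ_b (A(x−e_a,y)_{ab} − A(x,y)_{ab})·φ(y,b) = (A^{←}φ)(x,a)`. -/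
theorem applyK_shift_sub (A : MKer 4 (Fin 4)) (φ : Site 4 → Fin 4 → ℝ) (x : Site 4) (a : Fin 4)
    (h1 : ∀ b : Fin 4, Summable fun y : Site 4 => A x y a b * φ y b)
    (h2 : ∀ b : Fin 4, Summable fun y : Site 4 => A (x - unitVec a) y a b * φ y b) :
    applyK A φ (x - unitVec a) a - applyK A φ x a = applyK (fun x y a b => A (x - unitVec a) y a b - A x y a b) φ x a := by
  unfold applyK
  rw [← (summable_sum fun b _ => h2 b).tsum_sub (summable_sum fun b _ => h1 b)]
  refine tsum_congr fun y => ?_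
  rw [← Finset.sum_sub_distrib]
  exact Finset.sum_congr rfl fun b _ => by ring

/-! ## §2 One-step shifts of damped Coulomb letters -/

/-- [folklore] **ONE LATTICE STEP IN A DAMPED COULOMB LETTER** (`‖e‖∞ ≤ 1`, `0 ≤ ε ≤ ε₁`, `K ≥ 0`):
`K·e^{−ε‖z−e‖}∕nrm(z−e)^p ≤ 2^p·e^{ε₁}·K·e^{−ε‖z‖}∕nrm(z)^p` (`‖z‖ ≤ ‖z−e‖ + 1`, `nrm z ≤ 2·nrm(z−e)`). -/
theorem profile_shift_le {K ε ε₁ : ℝ} (hK : 0 ≤ K) (hε : 0 ≤ ε) (hε₁ : ε ≤ ε₁) (p : ℕ) (z e : Site 4) (he : supNorm e ≤ 1) :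
    K * Real.exp (-ε * supNorm (z - e)) / nrm (z - e) ^ p ≤ 2 ^ p * Real.exp ε₁ * K * Real.exp (-ε * supNorm z) / nrm z ^ p := by
  have hz : supNorm z ≤ supNorm (z - e) + 1 := by
    have h := supNorm_add_le (z - e) e
    rw [sub_add_cancel] at h
    omega
  have hz' : (supNorm z : ℝ) ≤ (supNorm (z - e) : ℝ) + 1 := by exact_mod_cast hz
  have hn0 := nrm_pos (d := 4) z
  have hnrm : nrm z ≤ 2 * nrm (z - e) := by
    have hm1 : (1 : ℝ) ≤ max 1 (supNorm (z - e) : ℝ) := le_max_left _ _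
    have hm2 : (supNorm (z - e) : ℝ) ≤ max 1 (supNorm (z - e) : ℝ) := le_max_right _ _
    rw [nrm_eq_max, nrm_eq_max]
    exact max_le (by linarith) (by linarith)
  have hexp : Real.exp (-ε * supNorm (z - e)) ≤ Real.exp ε₁ * Real.exp (-ε * supNorm z) := by
    rw [← Real.exp_add, Real.exp_le_exp]; nlinarith
  have hpow : nrm z ^ p ≤ 2 ^ p * nrm (z - e) ^ p := by
    rw [← mul_pow]; exact pow_le_pow_left₀ hn0.le hnrm p
  have hne := pow_pos (nrm_pos (d := 4) (z - e)) p
  have hnz := pow_pos hn0 p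
  rw [div_le_div_iff₀ hne hnz]
  calc K * Real.exp (-ε * supNorm (z - e)) * nrm z ^ p
      ≤ K * (Real.exp ε₁ * Real.exp (-ε * supNorm z)) * (2 ^ p * nrm (z - e) ^ p) :=
        mul_le_mul (mul_le_mul_of_nonneg_left hexp hK) hpow hnz.le (by positivity)
    _ = 2 ^ p * Real.exp ε₁ * K * Real.exp (-ε * supNorm z) * nrm (z - e) ^ p := by ring

/-- [folklore] `‖e_a‖∞ ≤ 1` and `‖−e_a‖∞ ≤ 1`. -/
theorem supNorm_unitVec_le (a : Fin 4) : supNorm (unitVec a : Site 4) ≤ 1 ∧ supNorm (-(unitVec a : Site 4)) ≤ 1 := by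
  constructor
  · exact supNorm_single_one a
  · rw [supNorm_neg]; exact supNorm_single_one a

/-- [folklore] **BACKWARD d1 LETTER, FIRST SITE**: a forward letter `|A(x+e_β,y) − A(x,y)| ≤ K·e^{−ε‖x−y‖}∕nrm(x−y)³` (all `x,y,c,b,β`; `0 ≤ ε ≤ ε₁`) gives
`|A(x−e_a,y)_{ab} − A(x,y)_{ab}| ≤ 8e^{ε₁}K·e^{−ε‖x−y‖}∕nrm(x−y)³`. -/
theorem abs_sub_left_le_of_letter {A : MKer 4 (Fin 4)} {K ε ε₁ : ℝ} (hK : 0 ≤ K) (hε : 0 ≤ ε) (hε₁ : ε ≤ ε₁)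
    (h : ∀ (x y : Site 4) (c b β : Fin 4), |A (x + unitVec β) y c b - A x y c b| ≤ K * Real.exp (-ε * supNorm (x - y)) / nrm (x - y) ^ 3)
    (x y : Site 4) (a b : Fin 4) :
    |A (x - unitVec a) y a b - A x y a b| ≤ 8 * Real.exp ε₁ * K * Real.exp (-ε * supNorm (x - y)) / nrm (x - y) ^ 3 := by
  have h1 := h (x - unitVec a) y a b a
  rw [sub_add_cancel, abs_sub_comm] at h1
  refine h1.trans ?_
  have e1 : x - unitVec a - y = (x - y) - unitVec a := by abel
  rw [e1]
  have h2 := profile_shift_le hK hε hε₁ 3 (x - y) (unitVec a) (supNorm_unitVec_le a).1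
  norm_num at h2 ⊢
  exact h2

/-- [folklore] **BACKWARD d1 LETTER, SECOND SITE**: a forward letter `|A(x,y+e_β) − A(x,y)| ≤ K·e^{−ε‖x−y‖}∕nrm(x−y)³` gives
`|A(x,y−e_b)_{cb} − A(x,y)_{cb}| ≤ 8e^{ε₁}K·e^{−ε‖x−y‖}∕nrm(x−y)³`. -/
theorem abs_sub_right_le_of_letter {A : MKer 4 (Fin 4)} {K ε ε₁ : ℝ} (hK : 0 ≤ K) (hε : 0 ≤ ε) (hε₁ : ε ≤ ε₁)
    (h : ∀ (x y : Site 4) (c b β : Fin 4), |A x (y + unitVec β) c b - A x y c b| ≤ K * Real.exp (-ε * supNorm (x - y)) / nrm (x - y) ^ 3)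
    (x y : Site 4) (c b : Fin 4) :
    |A x (y - unitVec b) c b - A x y c b| ≤ 8 * Real.exp ε₁ * K * Real.exp (-ε * supNorm (x - y)) / nrm (x - y) ^ 3 := by
  have h1 := h x (y - unitVec b) c b b
  rw [sub_add_cancel, abs_sub_comm] at h1
  refine h1.trans ?_
  have e1 : x - (y - unitVec b) = (x - y) - (-(unitVec b)) := by abel
  rw [e1]
  have h2 := profile_shift_le hK hε hε₁ 3 (x - y) (-(unitVec b)) (supNorm_unitVec_le b).2
  norm_num at h2 ⊢
  exact h2

/-- [folklore] **SHIFTED ENTRY LETTER, SECOND SITE**: `|A(x,y)| ≤ K·e^{−ε‖x−y‖}∕nrm(x−y)²` gives `|A(x,y−e_b)_{cb}| ≤ 4e^{ε₁}K·e^{−ε‖x−y‖}∕nrm(x−y)²`. -/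
theorem abs_shift_right_le_of_letter {A : MKer 4 (Fin 4)} {K ε ε₁ : ℝ} (hK : 0 ≤ K) (hε : 0 ≤ ε) (hε₁ : ε ≤ ε₁)
    (h : ∀ (x y : Site 4) (c b : Fin 4), |A x y c b| ≤ K * Real.exp (-ε * supNorm (x - y)) / nrm (x - y) ^ 2) (x y : Site 4) (c b : Fin 4) :
    |A x (y - unitVec b) c b| ≤ 4 * Real.exp ε₁ * K * Real.exp (-ε * supNorm (x - y)) / nrm (x - y) ^ 2 := by
  refine (h x (y - unitVec b) c b).trans ?_
  have e1 : x - (y - unitVec b) = (x - y) - (-(unitVec b)) := by abel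
  rw [e1]
  have h2 := profile_shift_le hK hε hε₁ 2 (x - y) (-(unitVec b)) (supNorm_unitVec_le b).2
  norm_num at h2 ⊢
  exact h2

/-- [folklore] **SHIFTED ENTRY LETTER, FIRST SITE**: `|A(x,y)| ≤ K·e^{−ε‖x−y‖}∕nrm(x−y)²` gives `|A(x−e_a,y)_{ab}| ≤ 4e^{ε₁}K·e^{−ε‖x−y‖}∕nrm(x−y)²`. -/
theorem abs_shift_left_le_of_letter {A : MKer 4 (Fin 4)} {K ε ε₁ : ℝ} (hK : 0 ≤ K) (hε : 0 ≤ ε) (hε₁ : ε ≤ ε₁)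
    (h : ∀ (x y : Site 4) (c b : Fin 4), |A x y c b| ≤ K * Real.exp (-ε * supNorm (x - y)) / nrm (x - y) ^ 2) (x y : Site 4) (a b : Fin 4) :
    |A (x - unitVec a) y a b| ≤ 4 * Real.exp ε₁ * K * Real.exp (-ε * supNorm (x - y)) / nrm (x - y) ^ 2 := by
  refine (h (x - unitVec a) y a b).trans ?_
  have e1 : x - unitVec a - y = (x - y) - unitVec a := by abel
  rw [e1]
  have h2 := profile_shift_le hK hε hε₁ 2 (x - y) (unitVec a) (supNorm_unitVec_le a).1
  norm_num at h2 ⊢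
  exact h2

/-! ## §3 The by-parts profile of `A∇f` for a site function with the dipole letter -/

/-- [folklore] **(L1)-d1 BY PARTS: `|(A∇f)(x,c)| ≤ 4·K₁·B·C₄·e^{−ε‖x−v‖∞}∕nrm(x−v)²`** (`C₄ = 4·2⁷·9³`) from the backward second-site letter
`|A(x,y−e_b)_{cb} − A(x,y)_{cb}| ≤ K₁·e^{−ε‖x−y‖}∕nrm(x−y)³`, the entry letters `K₀e∕nrm²` (unshifted and shifted, for the summabilities) and the site letter
`|f y| ≤ B·e^{−ε‖y−v‖}∕nrm(y−v)³`: `applyK_grad_eq` + `abs_applyK_le_of_damped_profiles` at the exponents `(3,3) ↦ 2`. -/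
theorem abs_applyK_grad_le_of_damped_profiles {A : MKer 4 (Fin 4)} {f : Site 4 → ℝ} {K₀ K₀' K₁ B ε : ℝ} (hK₀ : 0 ≤ K₀) (hK₀' : 0 ≤ K₀')
    (hK₁ : 0 ≤ K₁) (hB : 0 ≤ B) (hε : 0 ≤ ε) (v : Site 4)
    (hA0 : ∀ (x y : Site 4) (c b : Fin 4), |A x y c b| ≤ K₀ * Real.exp (-ε * supNorm (x - y)) / nrm (x - y) ^ 2)
    (hA0' : ∀ (x y : Site 4) (c b : Fin 4), |A x (y - unitVec b) c b| ≤ K₀' * Real.exp (-ε * supNorm (x - y)) / nrm (x - y) ^ 2)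
    (hA1 : ∀ (x y : Site 4) (c b : Fin 4), |A x (y - unitVec b) c b - A x y c b| ≤ K₁ * Real.exp (-ε * supNorm (x - y)) / nrm (x - y) ^ 3)
    (hf : ∀ y : Site 4, |f y| ≤ B * Real.exp (-ε * supNorm (y - v)) / nrm (y - v) ^ 3) (x : Site 4) (c : Fin 4) :
    |applyK A (grad f) x c| ≤ 4 * K₁ * B * (4 * 2 ^ (4 + 3) * 9 ^ (4 - 1)) * Real.exp (-ε * supNorm (x - v)) / nrm (x - v) ^ 2 := by
  -- the two summabilities from the entry letters, exponents (2,3) ↦ 1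
  have hA0s : ∀ (y : Site 4) (b : Fin 4), |A x y c b| ≤ K₀ * Real.exp (-ε * supNorm (y - x)) / nrm (y - x) ^ 2 := fun y b => by
    rw [← neg_sub x y, supNorm_neg, nrm_neg]; exact hA0 x y c b
  have hA0s' : ∀ (y : Site 4) (b : Fin 4), |A x (y - unitVec b) c b| ≤ K₀' * Real.exp (-ε * supNorm (y - x)) / nrm (y - x) ^ 2 := fun y b => by
    rw [← neg_sub x y, supNorm_neg, nrm_neg]; exact hA0' x y c b
  have h1 : ∀ b : Fin 4, Summable fun y : Site 4 => A x y c b * f y := fun b =>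
    (LatticeHLSDamped.abs_tsum_mul_le_of_damped_profiles (d := 4) (by norm_num) (a := 2) (b := 3) (by norm_num) (by norm_num) (by norm_num)
      hK₀ hB hε x v (fun y => hA0s y b) hf).1
  have h2 : ∀ b : Fin 4, Summable fun y : Site 4 => A x (y - unitVec b) c b * f y := fun b =>
    (LatticeHLSDamped.abs_tsum_mul_le_of_damped_profiles (d := 4) (by norm_num) (a := 2) (b := 3) (by norm_num) (by norm_num) (by norm_num)
      hK₀' hB hε x v (fun y => hA0s' y b) hf).1
  rw [applyK_grad_eq A f x c h1 h2]
  have h := abs_applyK_le_of_damped_profiles (d := 4) (F := Fin 4) (by norm_num) (a := 3) (b := 3) (by norm_num) (by norm_num) (by norm_num)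
    (A := fun x y c b => A x (y - unitVec b) c b - A x y c b) (φ := fun y (_ : Fin 4) => f y) hK₁ hB hε v
    (fun x y c b => hA1 x y c b) (fun y _ => hf y) x c
  simp only [Fintype.card_fin] at h
  norm_num at h ⊢
  exact h

end Summit.QuantumFields.BalabanUV.Beta.D1BFx.PairingByParts

end
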